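import Summits.QuantumFields.YangMills.Theorems.IR.AfPincerUcPortSpec
import Literature.Probability.LatticeModels.CoarseCellMixingPeierls

/-!
# The box instance of the defect engine for the `af-pincer-Uc` port: the uniform kernel Peierls bound (P4)

Helper lemma for item `stmt-QuantumFields-19354` (crux `IR`, line `af-pincer-Uc`, stub `stub_typCriterionUc`; architecture
δ' of `MEMO-g6-port-map.md`, obligation P4 of its §3 table):

`uniformKernelPeierls_boxSpec`: if `Typ` is cell-local, satisfies the slot's clause (ii) in UKP form (`ClauseIIukp ρ β w δ Typ`,
spelled out: for `F ⊆ F'`, `F ≠ ∅` and every exterior whose cells within sup-distance `1` of a charged cell are resampled or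
typical, `γ_{F'}{all cells of F atypical} ≤ δ^{#F}`) and the padding is typical everywhere, then the box
specification satisfies the engine's `UniformKernelPeierls (boxCell w x₀ m n) (boxSpec …) (boxGood w x₀ m n pad Typ) δ`.

Proof.  Let `D` be the charged labels.  A phantom label in `D` makes the all-bad event empty; a charged label whose cell is
not resampled is good in the exterior (engine premise at distance `0`), hence a.s. good under the kernel (properness) —
event null.  Otherwise the charged labels are the labels of a set `F` of resampled cells, `#F = #D`, and clause (ii) with
`F' :=` the resampled cells and the padded exterior applies: a `ℤ⁴`-neighbour of a charged cell inside the box is a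
label-neighbour (label distance = cell distance on the box), so it is resampled or good-in-the-exterior = typical; outside
the box the padded exterior is the (typical) padding.

HONEST FRAMING: bookkeeping for one stub of one open gap-crux of a CONDITIONAL chain; no claim about the crux or the gap.
-/

set_option autoImplicit false

noncomputable section

open MeasureTheory
open scoped ENNReal
open Literature.MathematicalPhysics.QuantumLattice
open Literature.Probability.LatticeModels
open Summit.QuantumFields.YangMills.Cruxes.IR.Tempered (cellEdges regionEdges)
open Summit.QuantumFields.YangMills.Cruxes.IR.CellTempered.Engine (frameCell frameCell_eq_iff mem_cellEdges_frameCell)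

namespace Summit.QuantumFields.YangMills.Cruxes.IR.AfPincerUc.Port

section Peierls

variable {G : Type} [Group G] [TopologicalSpace G] [IsTopologicalGroup G] [CompactSpace G]
  [MeasurableSpace G] [BorelSpace G] [T2Space G] [SecondCountableTopology G]
variable {N : ℕ} (ρ : G →* Matrix (Fin N) (Fin N) ℂ) (hρ : Continuous ρ) (β : ℝ)
  {w : Fin 4 → ℤ → ℤ} (hw : ∀ i j, w i j + 1 ≤ w i (j + 1)) (x₀ : Fin 4 → ℤ) (m n : ℕ) (pad : LGConfig 4 G)
  {Typ : (Fin 4 → ℤ) → Set (LGConfig 4 G)} {δ : ℝ}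

omit [T2Space G] [SecondCountableTopology G] in
include hw in
/-- Every `ℤ⁴` cell of a frame with steps `≥ 1` has a link (the link at its lowest corner, direction `0`). -/
theorem exists_mem_cellEdges (y : Fin 4 → ℤ) : ∃ e : ZdEdge 4, frameCell w e = y := by
  refine ⟨(fun i => w i (y i), 0), (frameCell_eq_iff hw _ y).2 ?_⟩
  simp only [Summit.QuantumFields.YangMills.Cruxes.IR.Tempered.cellEdges, Finset.mem_product, Finset.mem_univ,
    and_true, Fintype.mem_piFinset, Finset.mem_Ico]
  intro i
  exact ⟨le_rfl, by linarith [hw i (y i)]⟩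

omit [Group G] [TopologicalSpace G] [IsTopologicalGroup G] [CompactSpace G] [MeasurableSpace G] [BorelSpace G]
  [T2Space G] [SecondCountableTopology G] in
include hw in
/-- On a box cell, typicality of the re-padded configuration `boxExt pad (boxRestrict σ)` is typicality of `σ`. -/
theorem boxExt_boxRestrict_mem_iff (hTd : ∀ c, DependsOn (fun σ : LGConfig 4 G => σ ∈ Typ c) ↑(cellEdges w c))
    (σ : LGConfig 4 G) {y : Fin 4 → ℤ} (hy : y ∈ boxCells x₀ m) :
    boxExt w x₀ m pad (boxRestrict w x₀ m σ) ∈ Typ y ↔ σ ∈ Typ y := by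
  have key : (boxExt w x₀ m pad (boxRestrict w x₀ m σ) ∈ Typ y) = (σ ∈ Typ y) := by
    refine hTd y fun e he => ?_
    have heB : e ∈ boxEdges w x₀ m := by
      rw [mem_boxEdges_iff hw, (frameCell_eq_iff hw e y).2 (Finset.mem_coe.1 he)]
      exact hy
    rw [boxExt_apply_mem pad _ heB]
    rfl
  rw [key]

include hρ hw in
/-- **P4 — the uniform kernel Peierls bound of the box instance** from cell-locality of `Typ`, the slot's clause (ii) in
UKP form (spelled out), and typicality of the padding. -/
theorem uniformKernelPeierls_boxSpec (hTm : ∀ c, MeasurableSet (Typ c))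
    (hTd : ∀ c, DependsOn (fun σ : LGConfig 4 G => σ ∈ Typ c) ↑(cellEdges w c))
    (hII : ∀ F F' : Finset (Fin 4 → ℤ), F ⊆ F' → F.Nonempty → ∀ ζ : LGConfig 4 G,
      (∀ c ∈ F, ∀ c' : Fin 4 → ℤ, (∀ i, |c' i - c i| ≤ 1) → c' ∈ F' ∨ ζ ∈ Typ c') →
        (ymSpecification ρ β (regionEdges w F') ζ) {σ : LGConfig 4 G | ∀ c ∈ F, σ ∉ Typ c} ≤
          ENNReal.ofReal (δ ^ F.card))
    (hpad : ∀ c, pad ∈ Typ c) :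
    UniformKernelPeierls (boxCell w x₀ m n) (boxSpec ρ β w x₀ m pad) (boxGood w x₀ m n pad Typ) δ := by
  classical
  intro A hAunion ζ D hprem
  have hγ := isSpecification_boxSpec ρ hρ β x₀ m pad (w := w)
  haveI := hγ.isProbability A ζ
  set ι : BoxLink w x₀ m ↪ ZdEdge 4 := Function.Embedding.subtype fun e => e ∈ boxEdges w x₀ m with hι
  obtain ⟨Y, hYB, hAY, hAmap⟩ := exists_cells_of_union hw A hAunion
  have hEv : MeasurableSet {σ : BoxLink w x₀ m → G | ∀ c ∈ D, σ ∉ boxGood w x₀ m n pad Typ c} :=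
    measurableSet_allBad (fun c => measurableSet_boxGood pad hTm c) D
  -- Case 1: some charged label is phantom — the event is empty.
  by_cases hph : ∃ c ∈ D, ∀ y ∈ boxCells x₀ m, boxLabel x₀ m n y ≠ c
  · obtain ⟨c, hcD, hc⟩ := hph
    have hempty : {σ : BoxLink w x₀ m → G | ∀ c ∈ D, σ ∉ boxGood w x₀ m n pad Typ c} = ∅ := by
      ext σ
      simp only [Set.mem_setOf_eq, Set.mem_empty_iff_false, iff_false, not_forall, not_not]
      exact ⟨c, hcD, mem_boxGood_of_phantom pad Typ hc σ⟩
    rw [hempty, measure_empty]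
    exact zero_le
  push Not at hph
  -- every charged label is the label of a box cell
  choose yOf hyOfB hyOf using hph
  -- Case 2: some charged cell is not resampled — it is good in `ζ`, hence a.s. good under the kernel.
  by_cases hfrozen : ∃ c, ∃ h : c ∈ D, yOf c h ∉ Y
  · obtain ⟨c, hcD, hcY⟩ := hfrozen
    have hfree : ∀ v : BoxLink w x₀ m, boxCell w x₀ m n v = c → v ∉ A := by
      intro v hv hvA
      have h1 : frameCell w v.1 = yOf c hcD :=
        (boxCell_eq_boxLabel_iff hw v (hyOfB c hcD)).1 (by rw [hv, hyOf c hcD])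
      exact hcY (h1 ▸ (hAY v).1 hvA)
    -- the engine premise at distance `0`: resampled (impossible) or good in `ζ`
    have hgoodζ : ζ ∈ boxGood w x₀ m n pad Typ c := by
      rcases hprem c hcD c (by rw [cdist_self]; exact zero_le_one) with hall | hg
      · exfalso
        obtain ⟨e, he⟩ := exists_mem_cellEdges hw (yOf c hcD)
        have heB : e ∈ boxEdges w x₀ m := (mem_boxEdges_iff hw e).2 (he ▸ hyOfB c hcD)
        have hvc : boxCell w x₀ m n ⟨e, heB⟩ = c := by
          rw [← hyOf c hcD]; exact (boxCell_eq_boxLabel_iff hw ⟨e, heB⟩ (hyOfB c hcD)).2 he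
        exact hfree ⟨e, heB⟩ hvc (hall ⟨e, heB⟩ hvc)
      · exact hg
    have hae : ∀ᵐ σ ∂(boxSpec ρ β w x₀ m pad A ζ), σ ∈ boxGood w x₀ m n pad Typ c := by
      filter_upwards [hγ.proper A ζ] with σ hσ
      exact (boxGood_local hw hTd pad c σ ζ fun v hv => hσ v (hfree v hv)).2 hgoodζ
    have hnull : boxSpec ρ β w x₀ m pad A ζ {σ | ¬ σ ∈ boxGood w x₀ m n pad Typ c} = 0 := ae_iff.1 hae
    calc boxSpec ρ β w x₀ m pad A ζ {σ | ∀ c ∈ D, σ ∉ boxGood w x₀ m n pad Typ c}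
        ≤ boxSpec ρ β w x₀ m pad A ζ {σ | ¬ σ ∈ boxGood w x₀ m n pad Typ c} :=
          measure_mono fun σ hσ => hσ c hcD
      _ = 0 := hnull
      _ ≤ _ := zero_le
  push Not at hfrozen
  -- Case 3: every charged cell is resampled — clause (ii) for the charged cells `F` inside the resampled cells `Y`.
  by_cases hD : D = ∅
  · subst hD
    simp
  set F : Finset (Fin 4 → ℤ) := D.attach.image fun c => yOf c.1 c.2 with hF
  have hmemF : ∀ y, y ∈ F ↔ ∃ c, ∃ h : c ∈ D, yOf c h = y := by
    intro y
    simp only [hF, Finset.mem_image, Finset.mem_attach, true_and, Subtype.exists]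
  have hFY : F ⊆ Y := by
    intro y hy
    obtain ⟨c, hc, rfl⟩ := (hmemF y).1 hy
    exact hfrozen c hc
  have hFne : F.Nonempty := by
    obtain ⟨c, hc⟩ := Finset.nonempty_iff_ne_empty.2 hD
    exact ⟨yOf c hc, (hmemF _).2 ⟨c, hc, rfl⟩⟩
  have hinj : Function.Injective fun c : {c // c ∈ D} => yOf c.1 c.2 := by
    intro c c' h
    apply Subtype.ext
    have h1 := hyOf c.1 c.2
    have h2 := hyOf c'.1 c'.2
    simp only at h
    rw [← h1, ← h2, h]
  have hcard : F.card = D.card := by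
    rw [hF, Finset.card_image_of_injective _ hinj, Finset.card_attach]
  -- the premise of clause (ii) for the padded exterior
  have hpremise : ∀ y ∈ F, ∀ c' : Fin 4 → ℤ, (∀ i, |c' i - y i| ≤ 1) →
      c' ∈ Y ∨ boxExt w x₀ m pad ζ ∈ Typ c' := by
    intro y hy c' hc'
    obtain ⟨c, hc, rfl⟩ := (hmemF y).1 hy
    by_cases hc'B : c' ∈ boxCells x₀ m
    · have hnear : cdist c (boxLabel x₀ m n c') ≤ 1 := by
        rw [← hyOf c hc, cdist_boxLabel (hyOfB c hc) hc'B, cellDist_le_iff]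
        intro i
        rw [abs_sub_comm]
        exact hc' i
      rcases hprem c hc (boxLabel x₀ m n c') hnear with hall | hg
      · left
        obtain ⟨e, he⟩ := exists_mem_cellEdges hw c'
        have heB : e ∈ boxEdges w x₀ m := (mem_boxEdges_iff hw e).2 (he ▸ hc'B)
        have hvc : boxCell w x₀ m n ⟨e, heB⟩ = boxLabel x₀ m n c' :=
          (boxCell_eq_boxLabel_iff hw ⟨e, heB⟩ hc'B).2 he
        exact he ▸ (hAY ⟨e, heB⟩).1 (hall ⟨e, heB⟩ hvc)
      · exact Or.inr ((mem_boxGood_iff pad Typ hc'B ζ).1 hg)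
    · exact Or.inr ((boxExt_mem_iff_pad_mem hw hTd pad ζ hc'B).2 (hpad c'))
  have hbound := hII F Y hFY hFne (boxExt w x₀ m pad ζ) hpremise
  rw [boxSpec_apply ρ β w x₀ m pad A ζ hEv, hAmap, ← hcard]
  refine le_trans (measure_mono ?_) hbound
  intro σ hσ y hy
  obtain ⟨c, hc, rfl⟩ := (hmemF y).1 hy
  have h1 : boxRestrict w x₀ m σ ∉ boxGood w x₀ m n pad Typ c := hσ c hc
  rw [← hyOf c hc, mem_boxGood_iff pad Typ (hyOfB c hc), boxExt_boxRestrict_mem_iff hw x₀ m pad hTd σ (hyOfB c hc)] at h1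
  exact h1

end Peierls

end Summit.QuantumFields.YangMills.Cruxes.IR.AfPincerUc.Port

end
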